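import Summits.Ventures.PercRepro.FaceDecide

/-!
# Every configuration is the code configuration of its code

`encode u = ∑ e, if u e then 2^e else 0` and **`cfgOf_encode : cfgOf k (encode u) = u`** — the one
identification lemma that replaces the per-case ones (`eq_top_bot_of_free`, `eq_codes_of_one_fixed`)
when the big faces of a `k`-edge graph are checked from a generated list of code pairs.
-/

namespace PercRepro

namespace MultiGraph

open Finset

/-- The code of a configuration: the sum of `2 ^ e` over its open edges. -/
def encode {k : ℕ} (u : Config (Fin k)) : ℕ := ∑ e : Fin k, if u e then 2 ^ e.val else 0

/-- The code of a configuration on `k + 1` edges: the bit of the edge `0` plus twice the code of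
the rest. -/
theorem encode_succ {k : ℕ} (u : Config (Fin (k + 1))) :
    encode u = (if u 0 then 1 else 0) + 2 * encode (fun e => u e.succ) := by
  unfold encode
  rw [Fin.sum_univ_succ, Finset.mul_sum]
  congr 1
  refine Finset.sum_congr rfl fun e _ => ?_
  split_ifs <;> simp [pow_succ, mul_comm]

/-- Codes are below `2 ^ k`. -/
theorem encode_lt {k : ℕ} (u : Config (Fin k)) : encode u < 2 ^ k := by
  induction k with
  | zero => simp [encode]
  | succ k ih =>
    rw [encode_succ, pow_succ]
    have := ih (fun e => u e.succ)
    split_ifs <;> omega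

/-- The bit `i < k` of the code of `u` is `u i`. -/
theorem testBit_encode {k : ℕ} (u : Config (Fin k)) (i : ℕ) (hi : i < k) :
    (encode u).testBit i = u ⟨i, hi⟩ := by
  induction k generalizing i with
  | zero => exact absurd hi (Nat.not_lt_zero _)
  | succ k ih =>
    rw [encode_succ]
    cases i with
    | zero =>
      rw [Nat.testBit_zero]
      have h0 : u ⟨0, hi⟩ = u 0 := congrArg u (Fin.ext rfl)
      rw [h0]
      cases hu : u 0
      · simp only [Bool.false_eq_true, ↓reduceIte, zero_add, decide_eq_false_iff_not]
        omega
      · simp only [↓reduceIte, decide_eq_true_eq]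
        omega
    | succ i =>
      rw [Nat.testBit_add_one]
      have hdiv : ((if u 0 then 1 else 0) + 2 * encode (fun e => u e.succ)) / 2 =
          encode (fun e => u e.succ) := by
        split_ifs <;> omega
      rw [hdiv, ih (fun e => u e.succ) i (Nat.lt_of_succ_lt_succ hi)]
      rfl

/-- **Every configuration is the code configuration of its code.** -/
theorem cfgOf_encode {k : ℕ} (u : Config (Fin k)) : cfgOf k (encode u) = u := by
  funext e
  simp only [cfgOf]
  exact testBit_encode u e.val e.isLt

/-- Bits at or above `k` of a code are off. -/
theorem testBit_encode_of_le {k : ℕ} (u : Config (Fin k)) (i : ℕ) (hi : k ≤ i) :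
    (encode u).testBit i = false :=
  Nat.testBit_lt_two_pow (lt_of_lt_of_le (encode_lt u) (Nat.pow_le_pow_right (by norm_num) hi))

/-- The code of the code configuration of `a < 2 ^ k` is `a`. -/
theorem encode_cfgOf {k : ℕ} (a : ℕ) (ha : a < 2 ^ k) : encode (cfgOf k a) = a := by
  apply Nat.eq_of_testBit_eq
  intro i
  by_cases hi : i < k
  · rw [testBit_encode _ i hi]
    rfl
  · rw [testBit_encode_of_le _ i (not_lt.mp hi)]
    exact (Nat.testBit_lt_two_pow (lt_of_lt_of_le ha
      (Nat.pow_le_pow_right (by norm_num) (not_lt.mp hi)))).symm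

end MultiGraph

end PercRepro
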